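import Literature.IUT.HodgeArakelov.RadialExamplesEx18iiProofs
import Literature.IUT.HodgeArakelov.GaloisPairRigidityMonoAnalytic
import Literature.IUT.HodgeArakelov.GoodPrimeKummerBridgeHolds
import Literature.IUT.HodgeArakelov.AbsTopMonoidsGenuineIsometriesProofs
import Literature.IUT.HodgeArakelov.TemperedThetaMonoidsSubdagStatements
import Literature.AnabelianGeometry.AbsoluteAnabelian.MonoidKummerMapsProofs
import HarnessLib

/-!
# [IUTchII] Rmk 1.11.1 (i) (a) and Prop 4.2 (i) AT THE GENUINE PRODUCERS — the named inputs `Rmk1111_a A`,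
# `IsTMPair`, «of mono-analytic type» DISCHARGED for `genuineOfModel` / `genuineOfModelIsm` (proof-only)

S. Mochizuki, *Inter-universal Teichmüller theory II*, kurims manuscript (Dec. 2020): §1 Example 1.8 (ii) p. 36
(«(∗⊳) … an MLF-Galois TM-pair … isomorphic to the MLF-Galois TM-pair determined by the natural action of `G_k` on
`O^⊳_k̄`»), Remark 1.11.1 (i) (a) pp. 49–50 («the group of automorphisms of the … MLF-Galois TM-pair `G ↷ O^⊳(G)`
maps bijectively [i.e., by forgetting `O^⊳(G)`] onto the group of automorphisms of the topological group `G`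
[cf. [AbsTopIII], Proposition 3.2, (iv)]»), §4 Proposition 4.2 (i) p. 124 [claim: Mochizuki2012, status: disputed]
(IUTchII §1 Rmk 1.11.1 (i), kurims pp.49-50). Record-only vocabulary under the claim key `Mochizuki2012` (D-0012,
disputed); abc-iut cell, layer L6, seat abc-iut-w6-d010 (row «RMK1111A-GENUINE», sequel of p428606). PROOF-ONLY
(no `def` / `structure` / `instance`).

The tree holds CONDITIONAL discharges over an ABSTRACT inhabitant `A : AbsTopMonoids S` of abc-iut-L6-t1's
[AbsTopIII]-output interface, with the side conditions BY NAME: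
* `Rmk1111_a_of_monoAnalyticLifts A hA hTM hMA hlift hdet : Rmk1111_a A` (abc-iut-L6-t23/w5,
  `GaloisPairRigidityMonoAnalytic`),
* `GoodPrimeKummer.prop42i_toPair A hA hTM f : Prop42i (A.toPair hA G) (A.toPair hA H) f` (abc-iut-L6-t5,
  `GoodPrimeKummerBridgeHolds`),
where `hA : A.ContinuityLaws`, `hTM : ∀ G, A.IsTMPair hA G`, `hMA : ∀ G, IsOfMonoAnalyticTypeMonoid .TM (A.toPair hA G)`,
and `hlift`, `hdet` are the [AbsTopIII] Prop. 3.2 (iv) lifting facts — the latter two PROVED in the tree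
(`galoisIsoLiftsToTMPairIsoOfMonoAnalytic_holds` = F-0410, abc-iut-L6-t13 over abc-iut-L4-d3;
`pairIsoDeterminedByGalois_holds`, abc-iut-L4-t2 lineage). With `genuineOfModel_continuityLaws` /
`genuineOfModel_isTMPair` (p428606) the remaining side conditions hold for abc-iut-L6-t13's GENUINE-mod-`ε` producer
`AbsTopMonoids.genuineOfModel S C ε hΔ hq` (`O^⊳(G) = 𝒪_k̄^⊳`) and — the `O^⊳`/`M_TM` sides being definitionally the
same — for abc-iut-L6-d2's fully genuine `AbsTopMonoids.genuineOfModelIsm S C ε hΔ hq`. This file records: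

* `genuineOfModel_isOfMonoAnalyticType` — the genuine pair `(G ↷ 𝒪_k̄^⊳)` is of MONO-ANALYTIC type ([AbsTopIII]
  Def. 3.1 (ii): isomorphic along `theta : G ⥲ Gal(k̄/k)` to the model pair with `ε_k = id`);
* `rmk1111_a_genuineOfModel`, `rmk1111_a_genuineOfModelIsm` — **IUTchII:Rmk1.11.1(i) (a) UNCONDITIONAL at the genuine
  producers**: `Aut(G ↷ O^⊳(G)) → Aut(G)` is bijective;
* `prop42i_genuineOfModel` — **IUTchII:Prop4.2(i)** (`GoodPrimeKummer.Prop42i`: exactly one equivariant monoid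
  isomorphism over every `f : G ⥲ G*`) at the genuine pairs, unconditionally;
* `genuineOfModelIsm_continuityLaws`, `genuineOfModelIsm_isTMPair`, `genuineOfModelIsm_isTMPairMTM`,
  `genuineOfModelIsm_isOfMonoAnalyticType`, `prop42i_genuineOfModelIsm` — the same side conditions / conclusions
  re-typed at the fully genuine producer;
* `prop34iiUniradialContent_genuineOfModelIsm`, `prop34iiUniradialContent_genuineOfModel` — **junction J13 of the
  sub-DAG of IUTchII:Prop3.4(ii)** (abc-iut-w5-d169's `TemperedThetaMonoids.Prop34iiUniradialContent A G`, [IUTchII]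
  Prop. 3.4 (ii) pp. 92–93 «fails to be compatible … with automorphisms of the pair `G_v ↷ (Ψ_{†C_v})^{×μ}` which arise
  from automorphisms of the pair `G_v ↷ (Ψ_{†C_v})^×` [cf. Remarks 1.11.1, (i), (b); 1.8.1]») HOLDS UNCONDITIONALLY at
  both genuine producers, for every `G`: the witness is INVERSION on `O^{×μ}(G)` (= the action of `−1 ∈ Ẑ^×` through
  `Ism(G)`, abc-iut-L6-d2's `actIsm_toIsm_negOneAut`), induced by the pair automorphism `(1, x ↦ x⁻¹)` of
  `G ↷ O^×(G)`, and induced by NO automorphism of `G ↷ O^⊳(G)` over `1` — the only one being the identity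
  (`rmk1111_a_genuineOfModel`), while `O^{×μ}(G)` has a class `x` with `x⁻¹ ≠ x` (abc-iut-L6-d2's `actIsm_toIsm_ne_one`).
  The tree's closer `prop34ii_uniradialContent_of_rmk1111` (abc-iut-w5-d169 lineage) takes `Rmk1111_a`, `Rmk1111_b`
  and a `Ẑ^×`-action `zhatPow` on `O^×(G)` BY NAME; at the genuine producers J13 needs none of (b).

So the hypothesis `(ha : Rmk1111_a A)` taken BY NAME by the Prop. 3.4 (ii) closers is discharged when `A` is either
genuine producer, and J13 itself holds there outright; `Rmk1111_b` (kernel `= Ẑ^×`, [AbsTopIII] Prop. 3.3 (ii)) and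
`Rmk181_statement` (LCFT) are NOT claimed. (abc-iut-w6-d016's `Rmk1111_a_of_isTMPair`, `GaloisPairRigidityForgetSurjective`,
reaches `Rmk1111_a A` from `hA`, `hTM` alone; the instance below goes through abc-iut-L6-t23's older closer — same conclusion.)
HONEST FRAMING: OUR kernel consequences of classical statements ([AbsTopIII] + LCFT inputs already proved in the
tree); nothing here bears on [IUTchIII] Cor. 3.12 or takes a side; typed ≠ proved for the abstract interface.
-/

noncomputable section

namespace Literature.IUT.HodgeArakelov

open CategoryTheory
open Literature.AnabelianGeometry.AbsoluteAnabelian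

namespace AbsTopMonoids

open Genuine

variable (S : ThetaSetting.{0}) (C : MLFClosure.{0}) (ε : S.Gk ≃ₜ* (ModelMLFGaloisData.galois C.k C.K).tmPair.Pi)
  (hΔ : ∀ f : S.PiX ≃ₜ* S.PiX, S.DeltaX.map f.toMulEquiv.toMonoidHom = S.DeltaX)
  (hq : Nonempty (TopGroup.quot S.PiX S.DeltaX ≃ₜ* S.Gk))

/-! ## The genuine-mod-`ε` producer `genuineOfModel` -/

/-- **IUTchII:Ex1.8(ii)** / [AbsTopIII] Def. 3.1 (ii) «of mono-analytic type» HOLDS for the genuine pair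
`(G ↷ O^⊳(G)) = (G ↷ 𝒪_k̄^⊳)` at every isomorph `G` of `G_k`: it is isomorphic, along `theta : G ⥲ Gal(k̄/k)`, to
abc-iut-L4-t2's mono-analytic model pair (`ε_k = id`, `isOfMonoAnalyticTypeMonoid_galois_tmPair`).
[claim: Mochizuki2012, status: disputed] (IUTchII §1 Ex 1.8 (ii), kurims p.36) -/
theorem genuineOfModel_isOfMonoAnalyticType (G : IsoClass S.Gk) :
    IsOfMonoAnalyticTypeMonoid .TM
      ((genuineOfModel S C ε hΔ hq).toPair (genuineOfModel_continuityLaws S C ε hΔ hq) G) := by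
  refine isOfMonoAnalyticTypeMonoid_of_iso ?_ (isOfMonoAnalyticTypeMonoid_galois_tmPair C)
  exact
    { isoPi := (theta C ε G).symm
      isoM := MulEquiv.refl _
      smul_comm := fun σ m => by
        show σ • m = theta C ε G ((theta C ε G).symm σ) • m
        rw [ContinuousMulEquiv.apply_symm_apply] }

/-- **IUTchII:Rmk1.11.1(i) (a) UNCONDITIONAL at the genuine-mod-`ε` producer** (kurims pp. 49–50): forgetting
`O^⊳(G) = 𝒪_k̄^⊳`, `Aut(G ↷ O^⊳(G)) → Aut(G)` is a BIJECTION at every isomorph `G` of `G_k` — abc-iut-L6-t23/w5's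
conditional discharge `Rmk1111_a_of_monoAnalyticLifts` with every side condition now a theorem: continuity laws
and `IsTMPair` (p428606), mono-analytic type (above), the lifting facts F-0410
`galoisIsoLiftsToTMPairIsoOfMonoAnalytic_holds` and `pairIsoDeterminedByGalois_holds` ([AbsTopIII] Prop. 3.2 (iv)).
[claim: Mochizuki2012, status: disputed] (IUTchII §1 Rmk 1.11.1 (i), kurims pp.49-50) -/
theorem rmk1111_a_genuineOfModel : Rmk1111_a (genuineOfModel S C ε hΔ hq) :=
  Rmk1111_a_of_monoAnalyticLifts (genuineOfModel S C ε hΔ hq) (genuineOfModel_continuityLaws S C ε hΔ hq)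
    (genuineOfModel_isTMPair S C ε hΔ hq) (genuineOfModel_isOfMonoAnalyticType S C ε hΔ hq)
    galoisIsoLiftsToTMPairIsoOfMonoAnalytic_holds pairIsoDeterminedByGalois_holds

/-- **IUTchII:Prop4.2(i) at the genuine pairs** (kurims p. 124; abc-iut-L6-t5's `GoodPrimeKummer.Prop42i`): over
every isomorphism `f : G ⥲ G*` of isomorphs of `G_k` there is EXACTLY ONE `f`-equivariant monoid isomorphism
`𝒪_k̄^⊳ ⥲ 𝒪_k̄^⊳` between the genuine pairs — `prop42i_toPair` with its `IsTMPair` hypothesis discharged.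
[claim: Mochizuki2012, status: disputed] (IUTchII §4 Prop 4.2 (i), kurims p.124) -/
theorem prop42i_genuineOfModel {G H : IsoClass S.Gk} (f : G ⟶ H) :
    GoodPrimeKummer.Prop42i ((genuineOfModel S C ε hΔ hq).toPair (genuineOfModel_continuityLaws S C ε hΔ hq) G)
      ((genuineOfModel S C ε hΔ hq).toPair (genuineOfModel_continuityLaws S C ε hΔ hq) H) (IsoClass.homIso f) :=
  GoodPrimeKummer.prop42i_toPair (genuineOfModel S C ε hΔ hq) (genuineOfModel_continuityLaws S C ε hΔ hq)
    (genuineOfModel_isTMPair S C ε hΔ hq) f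

/-! ## The fully genuine producer `genuineOfModelIsm` (abc-iut-L6-d2): same `O^⊳` / `M_TM` sides -/

/-- The continuity laws HOLD for `genuineOfModelIsm` (its `O^⊳`/`M_TM` sides ARE those of `genuineOfModel`).
[claim: Mochizuki2012, status: disputed] (IUTchII §1 Ex 1.8 (ii), kurims p.36) -/
theorem genuineOfModelIsm_continuityLaws : (genuineOfModelIsm S C ε hΔ hq).ContinuityLaws :=
  ⟨(genuineOfModel_continuityLaws S C ε hΔ hq).isOpen_stabilizer_otri,
    (genuineOfModel_continuityLaws S C ε hΔ hq).isOpen_stabilizer_mtm⟩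

/-- `IsTMPair` HOLDS for `genuineOfModelIsm` at every `G`. [claim: Mochizuki2012, status: disputed]
(IUTchII §1 Ex 1.8 (ii), kurims p.36) -/
theorem genuineOfModelIsm_isTMPair (G : IsoClass S.Gk) :
    (genuineOfModelIsm S C ε hΔ hq).IsTMPair (genuineOfModelIsm_continuityLaws S C ε hΔ hq) G :=
  genuineOfModel_isTMPair S C ε hΔ hq G

/-- `IsTMPairMTM` HOLDS for `genuineOfModelIsm` at every `Π`. [claim: Mochizuki2012, status: disputed]
(IUTchII §1 Ex 1.8 (ii), kurims p.36) -/
theorem genuineOfModelIsm_isTMPairMTM (P : IsoClass S.PiX) :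
    (genuineOfModelIsm S C ε hΔ hq).IsTMPairMTM (genuineOfModelIsm_continuityLaws S C ε hΔ hq) P :=
  genuineOfModel_isTMPairMTM S C ε hΔ hq P

/-- «Of mono-analytic type» HOLDS for the pairs of `genuineOfModelIsm`. [claim: Mochizuki2012, status: disputed]
(IUTchII §1 Ex 1.8 (ii), kurims p.36) -/
theorem genuineOfModelIsm_isOfMonoAnalyticType (G : IsoClass S.Gk) :
    IsOfMonoAnalyticTypeMonoid .TM
      ((genuineOfModelIsm S C ε hΔ hq).toPair (genuineOfModelIsm_continuityLaws S C ε hΔ hq) G) :=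
  genuineOfModel_isOfMonoAnalyticType S C ε hΔ hq G

/-- **IUTchII:Rmk1.11.1(i) (a) UNCONDITIONAL at the fully genuine producer** `genuineOfModelIsm` (abc-iut-L6-d2;
companion of its `rmk1111_d_genuineOfModelIsm`): `Aut(G ↷ O^⊳(G)) → Aut(G)` is bijective.
[claim: Mochizuki2012, status: disputed] (IUTchII §1 Rmk 1.11.1 (i), kurims pp.49-50) -/
theorem rmk1111_a_genuineOfModelIsm : Rmk1111_a (genuineOfModelIsm S C ε hΔ hq) :=
  rmk1111_a_genuineOfModel S C ε hΔ hq

/-- **IUTchII:Prop4.2(i)** at the pairs of the fully genuine producer. [claim: Mochizuki2012, status: disputed]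
(IUTchII §4 Prop 4.2 (i), kurims p.124) -/
theorem prop42i_genuineOfModelIsm {G H : IsoClass S.Gk} (f : G ⟶ H) :
    GoodPrimeKummer.Prop42i ((genuineOfModelIsm S C ε hΔ hq).toPair (genuineOfModelIsm_continuityLaws S C ε hΔ hq) G)
      ((genuineOfModelIsm S C ε hΔ hq).toPair (genuineOfModelIsm_continuityLaws S C ε hΔ hq) H) (IsoClass.homIso f) :=
  prop42i_genuineOfModel S C ε hΔ hq f

/-! ## Junction J13 of IUTchII:Prop3.4(ii) at the genuine producers -/

/-- **IUTchII:Prop3.4(ii), junction J13, UNCONDITIONAL at the fully genuine producer** `genuineOfModelIsm`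
(kurims pp. 92–93 «fails to be compatible … with automorphisms of the pair `G_v ↷ (Ψ_{†C_v})^{×μ}` which arise from
automorphisms of the pair `G_v ↷ (Ψ_{†C_v})^×` [cf. Remarks 1.11.1, (i), (b); 1.8.1]»; abc-iut-w5-d169's checkable content
`TemperedThetaMonoids.Prop34iiUniradialContent`): INVERSION on `O^{×μ}(G)` commutes with `G`, is induced by the pair
automorphism `(1, x ↦ x⁻¹)` of `G ↷ O^×(G)` (the action of `−1 ∈ Ẑ^×`), and is induced by NO automorphism of the TM-pair
`G ↷ O^⊳(G)` over `1 ∈ Aut(G)` — the only such being the identity (`rmk1111_a_genuineOfModel`), whereas `O^{×μ}(G)`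
has a class with `x⁻¹ ≠ x` (abc-iut-L6-d2's `actIsm_toIsm_ne_one` / `actIsm_toIsm_negOneAut`).
[claim: Mochizuki2012, status: disputed] (IUTchII §3 Prop 3.4 (ii), kurims pp.92-93) -/
theorem prop34iiUniradialContent_genuineOfModelIsm (G : IsoClass S.Gk) :
    TemperedThetaMonoids.Prop34iiUniradialContent (genuineOfModelIsm S C ε hΔ hq) G := by
  -- a class of `O^{×μ}(G)` not fixed by inversion (L6-d2: `−1 ∈ Ẑ^×` acts by inversion, non-trivially)
  have hx : ∃ y : (genuineOfModelIsm S C ε hΔ hq).Oxmu G, y⁻¹ ≠ y := by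
    by_contra hall
    refine actIsm_toIsm_ne_one S C ε hΔ hq G (MulEquiv.ext fun y => ?_)
    rw [actIsm_toIsm_negOneAut, MulAut.one_apply]
    by_contra hy
    exact hall ⟨y, hy⟩
  obtain ⟨y, hy⟩ := hx
  obtain ⟨x, rfl⟩ := QuotientGroup.mk_surjective y
  refine ⟨MulEquiv.inv _, fun g z => map_inv ((genuineOfModelIsm S C ε hΔ hq).actOxmu G g) z |>.symm, ?_, ?_⟩
  · -- induced by the pair automorphism `(1, inversion)` of `G ↷ O^×(G)`
    refine ⟨⟨((1 : Aut G), MulEquiv.inv _), fun g m => ?_⟩, rfl, fun z => rfl⟩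
    exact map_inv ((genuineOfModelIsm S C ε hΔ hq).actOunits G g) m
  · -- not induced by any automorphism of `G ↷ O^⊳(G)` over `1`: the only one is the identity ((a))
    intro q hq1
    have hq' : q = 1 :=
      (rmk1111_a_genuineOfModelIsm S C ε hΔ hq G).1 (hq1.trans (rfl : PairAut.forget (1 :
        PairAut G ((genuineOfModelIsm S C ε hΔ hq).Otri G) ((genuineOfModelIsm S C ε hΔ hq).actOtri G)) = 1).symm)
    subst hq'
    refine ⟨x, ?_⟩
    have hmap : Units.map (1 : PairAut G ((genuineOfModelIsm S C ε hΔ hq).Otri G)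
        ((genuineOfModelIsm S C ε hΔ hq).actOtri G)).1.2.toMonoidHom x = x := Units.ext rfl
    rw [hmap]
    intro h
    exact hy (by simpa using h.symm)

/-- **IUTchII:Prop3.4(ii), junction J13, UNCONDITIONAL at the genuine-mod-`ε` producer** `genuineOfModel` (its
`O^⊳`/`O^×`/`O^{×μ}` sides and `G`-actions ARE those of `genuineOfModelIsm`; J13 does not mention `Ism`).
[claim: Mochizuki2012, status: disputed] (IUTchII §3 Prop 3.4 (ii), kurims pp.92-93) -/
theorem prop34iiUniradialContent_genuineOfModel (G : IsoClass S.Gk) :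
    TemperedThetaMonoids.Prop34iiUniradialContent (genuineOfModel S C ε hΔ hq) G :=
  prop34iiUniradialContent_genuineOfModelIsm S C ε hΔ hq G

end AbsTopMonoids

end Literature.IUT.HodgeArakelov

end
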